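import Summits.QuantumAdvantage.QuantumAdvantage.Theorems.WalkKFormLossA
import HarnessLib

/-!
# Inverse-polynomial LOSS for every `k`-form / JLin strategy of the u-walk game, `p ≥ 5` — PART C: QUASI-POLYNOMIAL loss for
# POLYLOG-form strategies
(cell decomp-qadv, lens 6 «barrier-complement carving», g20 addendum 4; tree-ready, Prop-definition-free; Part A =
`Theorems.WalkKFormLossA` holds the subcube law `kForm_loss_ge` and the counting lemmas `mul_log_le_self`, `exists_pow_ratio_gt`.)

The characteristic-two subcube law of Part A with `m = k₀·(log₂ n + 2)^{e+1}` peels covers strategies whose cuts are arbitrary tables of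
`(log₂ n + 2)^e` linear forms `mod p` (every `e`): `kFormQuasiPolyLossOdd` — `2ⁿ ≤ 2^{k₀ (log₂ n + 2)^{e+1}} · #{losing inputs}`, i.e. a
QUASI-POLYNOMIALLY small but certified losing set.  This is the exact reach of the method in the number of forms: `O(log n)` forms ⇒
inverse-polynomial loss (Part B), `(log n)^{O(1)}` forms ⇒ quasi-polynomial loss (this file), constant `θ` ⇒ nothing (hitting-set ceiling
`2^{−m}`).

* `mul_pow_le_two_pow` — `k₀·(a+2)^e ≤ 2^a` eventually in `a`;
* `count_polylog_loss` — the counting inequality for `(log₂ n + 2)^e` forms with `k₀·(log₂ n + 2)^e` peels;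
* `kFormQuasiPolyLossOdd` — the quasi-polynomial loss theorem.

0 sorry; axioms standard; no `instance`, no `notation`, no `native_decide`.
-/

open Finset

namespace Summit.QuantumAdvantage.AdviceFreeQNC0

namespace Coset21

section PolylogCounting

/-- `k₀·(a+2)^e ≤ 2^a` for all `a ≥ a₀(k₀, e)`. -/
theorem mul_pow_le_two_pow (k₀ e : ℕ) : ∃ a₀ : ℕ, ∀ a ≥ a₀, k₀ * (a + 2) ^ e ≤ 2 ^ a := by
  refine ⟨max (2 ^ (2 * (2 * e))) (2 * e + 2 * k₀ + 2), fun a ha => ?_⟩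
  have ha1 : 2 ^ (2 * (2 * e)) ≤ a := le_trans (le_max_left _ _) ha
  have ha2 : 2 * e + 2 * k₀ + 2 ≤ a := le_trans (le_max_right _ _) ha
  -- `2e·log₂(a+2) ≤ a+2`
  have hlog : 2 * e * Nat.log 2 (a + 2) ≤ a + 2 := mul_log_le_self (2 * e) (a + 2) (by omega)
  -- `a + 2 < 2^{log₂(a+2)+1}`
  have hlt : a + 2 < 2 ^ (Nat.log 2 (a + 2) + 1) := Nat.lt_pow_succ_log_self (by norm_num) _
  have hk : k₀ < 2 ^ k₀ := Nat.lt_two_pow_self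
  have hexp : k₀ + (Nat.log 2 (a + 2) + 1) * e ≤ a := by
    have h1 : (Nat.log 2 (a + 2) + 1) * e = e * Nat.log 2 (a + 2) + e := by ring
    have h2 : 2 * (e * Nat.log 2 (a + 2)) ≤ a + 2 := by
      calc 2 * (e * Nat.log 2 (a + 2)) = 2 * e * Nat.log 2 (a + 2) := by ring
        _ ≤ a + 2 := hlog
    rw [h1]
    omega
  calc k₀ * (a + 2) ^ e ≤ 2 ^ k₀ * (2 ^ (Nat.log 2 (a + 2) + 1)) ^ e :=
        Nat.mul_le_mul hk.le (Nat.pow_le_pow_left hlt.le _)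
    _ = 2 ^ (k₀ + (Nat.log 2 (a + 2) + 1) * e) := by rw [← pow_mul, ← pow_add]
    _ ≤ 2 ^ a := Nat.pow_le_pow_right (by norm_num) hexp

/-- **The counting inequality for `(log₂ n + 2)^e` forms with `m = k₀·(log₂ n + 2)^e` peels** (`e ≥ 1`): for every `p ≥ 2` there
are `k₀, n₀` such that for all `n ≥ n₀`, `m ≤ n` and `(n+1)·2p^{(log₂ n+2)^e}·(2p−1)^m < (2p)^m`. -/
theorem count_polylog_loss (p : ℕ) (hp : 2 ≤ p) (e : ℕ) (he : 1 ≤ e) :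
    ∃ k₀ n₀ : ℕ, ∀ n ≥ n₀, k₀ * (Nat.log 2 n + 2) ^ e ≤ n ∧
      (n + 1) * (p ^ ((Nat.log 2 n + 2) ^ e) * 2) * (2 * p - 1) ^ (k₀ * (Nat.log 2 n + 2) ^ e)
        < (2 * p) ^ (k₀ * (Nat.log 2 n + 2) ^ e) := by
  -- a power `k₀` of the ratio `2p/(2p−1)` beating `2p`
  obtain ⟨k₀, hk₀⟩ := exists_pow_ratio_gt (2 * p - 1) (2 * p) (by omega)
  have hP1 : 2 * p - 1 + 1 = 2 * p := by omega
  rw [hP1] at hk₀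
  obtain ⟨a₀, ha₀⟩ := mul_pow_le_two_pow k₀ e
  refine ⟨k₀, 2 ^ a₀, fun n hn => ?_⟩
  have hn0 : n ≠ 0 := by have := Nat.one_le_two_pow (n := a₀); omega
  have ha : a₀ ≤ Nat.log 2 n :=
    calc a₀ = Nat.log 2 (2 ^ a₀) := (Nat.log_pow (by norm_num) _).symm
      _ ≤ Nat.log 2 n := Nat.log_mono_right hn
  have hm : k₀ * (Nat.log 2 n + 2) ^ e ≤ n := le_trans (ha₀ _ ha) (Nat.pow_log_le_self 2 hn0)
  refine ⟨hm, ?_⟩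
  have hnlt : n < 2 ^ (Nat.log 2 n + 1) := Nat.lt_pow_succ_log_self (by norm_num) n
  have hK2 : Nat.log 2 n + 2 ≤ (Nat.log 2 n + 2) ^ e := Nat.le_self_pow (by omega) _
  have h2K : (n + 1) * 2 ≤ 2 ^ ((Nat.log 2 n + 2) ^ e) :=
    calc (n + 1) * 2 ≤ 2 ^ (Nat.log 2 n + 1) * 2 := Nat.mul_le_mul_right 2 (Nat.succ_le_of_lt hnlt)
      _ = 2 ^ (Nat.log 2 n + 2) := by rw [← pow_succ]
      _ ≤ 2 ^ ((Nat.log 2 n + 2) ^ e) := Nat.pow_le_pow_right (by norm_num) hK2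
  have hKpos : (Nat.log 2 n + 2) ^ e ≠ 0 := by positivity
  calc (n + 1) * (p ^ ((Nat.log 2 n + 2) ^ e) * 2) * (2 * p - 1) ^ (k₀ * (Nat.log 2 n + 2) ^ e)
      = ((n + 1) * 2) * p ^ ((Nat.log 2 n + 2) ^ e) * (2 * p - 1) ^ (k₀ * (Nat.log 2 n + 2) ^ e) := by ring
    _ ≤ 2 ^ ((Nat.log 2 n + 2) ^ e) * p ^ ((Nat.log 2 n + 2) ^ e) * (2 * p - 1) ^ (k₀ * (Nat.log 2 n + 2) ^ e) :=
        Nat.mul_le_mul_right _ (Nat.mul_le_mul_right _ h2K)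
    _ = (2 * p * (2 * p - 1) ^ k₀) ^ ((Nat.log 2 n + 2) ^ e) := by rw [mul_pow, mul_pow, ← pow_mul]
    _ < ((2 * p) ^ k₀) ^ ((Nat.log 2 n + 2) ^ e) := Nat.pow_lt_pow_left hk₀ hKpos
    _ = (2 * p) ^ (k₀ * (Nat.log 2 n + 2) ^ e) := by rw [← pow_mul]

end PolylogCounting

section QuasiPolyLoss

variable (p : ℕ) [Fact p.Prime]

/-- **Quasi-polynomial loss for polylog-form strategies.**  For every prime `p ≥ 5` and every `e` there are `k₀, n₀` with
`2ⁿ ≤ 2^{k₀·(log₂ n + 2)^{e+1}} · #{losing inputs}` for every `n ≥ n₀`, every charge and every strategy each of whose cuts is an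
arbitrary table of `(log₂ n + 2)^e` linear forms `mod p` of the input (junta bits are coordinate forms).  `e = 0` (one form) and, by
padding, any `O(log n)` forms are the inverse-polynomial regime of Part B; this is the polylog regime. -/
theorem kFormQuasiPolyLossOdd (hp : 5 ≤ p) (e : ℕ) : ∃ k₀ n₀ : ℕ, ∀ n ≥ n₀, ∀ c : ℕ,
    ∀ (lam : Fin (n + 1) → Fin ((Nat.log 2 n + 2) ^ e) → Fin n → ZMod p)
      (F : Fin (n + 1) → (Fin ((Nat.log 2 n + 2) ^ e) → ZMod p) → Bool) (y : Fin (n + 1) → (Fin n → Bool) → Bool),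
      (∀ g u, y g u = F g (fun j => ∑ i, if u i = true then lam g j i else 0)) →
        2 ^ n ≤ 2 ^ (k₀ * (Nat.log 2 n + 2) ^ (e + 1)) *
          (Finset.univ.filter fun u : Fin n → Bool => ringWinU c y u = false).card := by
  obtain ⟨k₀, n₀, hn₀⟩ := count_polylog_loss p (by omega) (e + 1) (by omega)
  refine ⟨k₀, n₀, fun n hn c lam F y hy => ?_⟩
  obtain ⟨hm, hcount⟩ := hn₀ n hn
  have hp0 : 0 < p := by omega
  have hKK : (Nat.log 2 n + 2) ^ e ≤ (Nat.log 2 n + 2) ^ (e + 1) := Nat.pow_le_pow_right (by omega) (by omega)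
  have hcount' : (n + 1) * (p ^ ((Nat.log 2 n + 2) ^ e) * 2) * (2 * p - 1) ^ (k₀ * (Nat.log 2 n + 2) ^ (e + 1))
      < (2 * p) ^ (k₀ * (Nat.log 2 n + 2) ^ (e + 1)) :=
    lt_of_le_of_lt (Nat.mul_le_mul_right _ (Nat.mul_le_mul_left _ (Nat.mul_le_mul_right _
      (Nat.pow_le_pow_right hp0 hKK)))) hcount
  have hloss := kForm_loss_ge p hp (k₀ * (Nat.log 2 n + 2) ^ (e + 1)) hm hcount' c lam F y hy
  calc 2 ^ n = 2 ^ (k₀ * (Nat.log 2 n + 2) ^ (e + 1)) * 2 ^ (n - k₀ * (Nat.log 2 n + 2) ^ (e + 1)) := by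
        rw [← pow_add, Nat.add_sub_cancel' hm]
    _ ≤ 2 ^ (k₀ * (Nat.log 2 n + 2) ^ (e + 1)) *
          (Finset.univ.filter fun u : Fin n → Bool => ringWinU c y u = false).card := Nat.mul_le_mul_left _ hloss

end QuasiPolyLoss

end Coset21

end Summit.QuantumAdvantage.AdviceFreeQNC0
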